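import Summits.BirchSwinnertonDyer.BirchSwinnertonDyer.Theorems.KatoDescentTamePotSupersingularTameUpperDefectOfItems
import Summits.BirchSwinnertonDyer.BirchSwinnertonDyer.Theorems.KatoDescentTamePotSupersingularTameUpperHeegnerTwist
import Summits.BirchSwinnertonDyer.Rank1Residual.Additive.LocalTorsionExponent
import Summits.BirchSwinnertonDyer.Rank1Residual.Additive.KodairaDictionaryThree
import Summits.BirchSwinnertonDyer.Rank1Residual.Additive.LocalThreeTorsionIffTamagawaThreeOfIVHolds
import Summits.BirchSwinnertonDyer.Rank1Residual.X2.IsogenyClassStability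
import Literature.NumberTheory.EllipticCurves.MazurTorsionOrderValuationProofs
import Literature.NumberTheory.EllipticCurves.PastenValuationProductThm115Proofs
import Literature.NumberTheory.EllipticCurves.IsogenyConductorProofs
import Literature.NumberTheory.EllipticCurves.NeronComponentIndexTypeIIIProofs
import Literature.NumberTheory.EllipticCurves.NeronComponentIndexTypeIIIstarProofs
import Literature.NumberTheory.EllipticCurves.NeronComponentIndexTypeI0starProofs
import Literature.NumberTheory.EllipticCurves.NeronComponentIndexTypeInstarProofs
import Literature.NumberTheory.EllipticCurves.TamagawaNeZeroProofs
import Literature.NumberTheory.EllipticCurves.BSDInvariantsProofs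
import Literature.NumberTheory.EllipticCurves.GlobalMinimalModelProofs
import Literature.NumberTheory.EllipticCurves.ComplexMultiplicationBSDTripleProofs
import HarnessLib

/-!
# Route `KatoDescentTamePotSupersingular` (rung K8, sub-rung B4 (t′), cell `bsd-potss`): the
# `ℤ/p²`-MEMBER disjunct of the reducible-defect crux `TameUpperReducibleDefect` (item
# stmt-BirchSwinnertonDyer-19203, child of U₀ = item 19982) is VOID — unconditionally at `p ≥ 5`
# (no Mazur), and at `p = 3` on (t′) granted Ogg–Saito — so the crux IS its odd-parity rows
# (a `--supports … --as helper` file; seat `bsd-potss-k8t-c4` g3; nothing booked, BSD not proved by any of this)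

`TameUpperReducibleDefect` asks for the upper half `ord_p #Ш ≤ ord_p #Ш_an` on the rank-`0` (t′)
rows with `E[p]` REDUCIBLE that the member bound does not cover: a `ℚ`-isogenous `E'` with
`p² ∣ #E'(ℚ)_tors`, or `ord_p #Ш_an(E)` odd. Generation 0 of this seat reduced the crux to
"odd parity ∪ (`p = 3`, some isogenous `E'` with `9 ∣ #E'(ℚ)_tors`)" GRANTED Mazur's torsion theorem
(`tameUpperReducibleDefect_of_mazur_of_oddParity_of_nineTorsion`, p419146). This file removes both
the Mazur hypothesis and the `9`-torsion rows, by LOCAL torsion at the additive prime: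

* §1 `torsionOrder_dvd_natCard_torsion_padic` — `#E(ℚ)_tors ∣ #E(ℚ_p)_tors` (`E(ℚ) ↪ E(ℚ_p)`);
  `padicValNat_torsionOrder_le_one_of_addv_of_not_dvd` — for `W` globally minimal, additive at
  `p ≥ 3` with `p ∤ c_p`: `ord_p #E(ℚ)_tors ≤ 1` (`#E(ℚ_p)_tors ∣ c_p · p`, Silverman *AEC* VII.3.1 /
  VII.6.1: the b2b cell's `LocalLog.card_torsion_dvd_of_hasAdditiveReduction`).
* §2 `p ≥ 5`: `c_p ≤ 4 < p` (Kodaira–Néron, *ATAEC* IV.9.2(d), tree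
  `localTamagawaNumber_padic_le_four`), so **`not_sq_dvd_torsionOrder_of_isIsogenous_of_addv`**:
  `Addv W p → IsIsogenous W W' → ¬ p² ∣ #W'(ℚ)_tors` for EVERY elliptic `W'` (pass to a globally
  minimal model, `hasGlobalMinimalModel_rat_holds`; additive reduction transports,
  `Summit.BirchSwinnertonDyer.Rank1Residual.X2.addv_iff_of_isIsogenous`) — UNCONDITIONAL, no Mazur.
* §3 `p = 3`: on a globally minimal curve that is additive and TAME at `3` (`f₃ = 2`, i.e. Kodaira
  `Iₙ*`, `III`, `III*` — `condExpTwo_three_iff_kodairaSymbolAt_tame`) Tate's algorithm gives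
  `c₃ ∈ {1, 2, 4}` (tree `…_of_kodairaSymbolAt_eq_III/IIIstar/Istar_…_holds`), so `3 ∤ c₃` and
  `ord₃ #E(ℚ)_tors ≤ 1` (`not_nine_dvd_torsionOrder_of_condExpTwo_three`); along a `ℚ`-isogeny
  `f₃` is invariant GRANTED OGG–SAITO (`a_v(V_ℓ E) = f_v(E)`, the tree's named fact
  `artinConductorExponent_tate_eq_conductorExponent_of_isElliptic`, through
  `IsIsogenous.conductorExponent_int_eq_of_forall_tate`), whence
  **`not_nine_dvd_torsionOrder_of_isIsogenous_of_subTprime_three`**: on a (t′) row at `3`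
  (`e = 4`, Kodaira III/III*) NO isogenous curve has `9 ∣ #E'(ℚ)_tors`.
* §4 **`tameUpperReducibleDefect_of_oggSaito_of_oddParity`** — the RESHAPED COMPOSITION of the crux
  BY NAME: granted the Ogg–Saito schema, `TameUpperReducibleDefect` follows from the upper half on
  the rank-`0` (t′) rows with `E[p]` reducible and `ord_p #Ш_an` ODD alone; and
  `tameUpperReducibleDefect_of_oddParity_of_nineTorsion` — the same with NO named fact, the `p = 3`
  `9`-torsion rows kept as a hypothesis (g0's statement minus Mazur).

Honest note (unchanged from g0): in the BSD-true world the odd-parity rows are EMPTY (`#Ш_an = #Ш`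
is a square by Cassels–Tate), so they can only be closed by the exact formula there — the tenure
planner's queued retype of 19203 as the parity statement (TARGET R99). CONDITIONAL where marked
(audit `proof.conditional` on the Ogg–Saito binder); nothing about Ogg–Saito or the parity rows is
asserted; NO item is closed by this file.

References: [SilvermanAEC2009] VII.3 Prop. 3.1, VII.6 Thm. 6.1, Cor. VII.7.2, VIII.8 Cor. 8.3;
[SilvermanATAEC1994] IV.9.4 Steps 4, 6, 7, 9, Cor. IV.9.2(d), Table 4.1, Thm. IV.10.2, IV.11.1,
Exercise 4.40; [Mazur1977] Thm. (7') (NOT used); [Kato2004Asterisque] Thm. 14.5 (3) (context).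
-/

set_option autoImplicit false
-- sibling precedent (`KatoDescentPotSupersingularAssembly.lean`): the directory name repeats the summit name
set_option linter.dupNamespace false

noncomputable section

open scoped Classical

namespace Summit.BirchSwinnertonDyer.BirchSwinnertonDyer.Theorems

open WeierstrassCurve IsDedekindDomain Literature.NumberTheory.EllipticCurves
  Literature.NumberTheory.EllipticCurves.ModularForms
  Literature.NumberTheory.EllipticCurves.Rank1Residual
  Literature.NumberTheory.EllipticCurves.Rank1Residual.Typed
  Literature.NumberTheory.Automorphic Literature.NumberTheory.EllipticCurves.KrizLi2019
  Summit.BirchSwinnertonDyer.Rank1Residual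
  Summit.BirchSwinnertonDyer.Rank1Residual.Additive
  Summit.BirchSwinnertonDyer.BirchSwinnertonDyer.Theses.KatoDescentTamePotSupersingular

/-! ## §1 `#E(ℚ)_tors ∣ #E(ℚ_p)_tors`; `ord_p #E(ℚ)_tors ≤ 1` at an additive `p ≥ 3` with `p ∤ c_p` -/

section GlobalToLocal

variable (W : WeierstrassCurve ℚ) [W.IsElliptic] (p : ℕ) [hp : Fact p.Prime]

omit [W.IsElliptic] in
/-- **`#E(ℚ)_tors ∣ #E(ℚ_p)_tors`**: the injection `E(ℚ) ↪ E(ℚ_p)` (Mathlib's `Affine.Point.map`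
along `ℚ → ℚ_p`) restricts to an injective homomorphism of torsion subgroups (Lagrange; if
`E(ℚ_p)_tors` were infinite its `Nat.card` is `0` and the divisibility is trivial).
[cite: SilvermanAEC2009, VII.3 Prop. 3.1 (the standard use: `E(ℚ)_tors ↪ E(ℚ_p)`)] -/
theorem torsionOrder_dvd_natCard_torsion_padic :
    W.torsionOrder ∣ Nat.card (AddCommGroup.torsion (W.baseChange ℚ_[p]).toAffine.Point) := by
  set ι : W.toAffine.Point →+ (W.baseChange ℚ_[p]).toAffine.Point :=
    WeierstrassCurve.Affine.Point.map (W' := W.toAffine) (S := ℚ) (Algebra.ofId ℚ ℚ_[p]) with hι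
  have hinj : Function.Injective ι :=
    WeierstrassCurve.Affine.Point.map_injective (W' := W.toAffine) (f := Algebra.ofId ℚ ℚ_[p])
  set f : AddCommGroup.torsion W.toAffine.Point →+
      AddCommGroup.torsion (W.baseChange ℚ_[p]).toAffine.Point :=
    (ι.comp (AddCommGroup.torsion W.toAffine.Point).subtype).codRestrict _ (fun x ↦ by
      rw [AddCommGroup.mem_torsion]
      exact ι.isOfFinAddOrder ((AddCommGroup.mem_torsion _).mp x.2)) with hf
  have hfinj : Function.Injective f := by
    intro x y hxy
    apply Subtype.ext
    apply hinj
    simpa [hf] using congrArg Subtype.val hxy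
  rw [torsionOrder_eq_natCard_torsion]
  exact AddSubgroup.card_dvd_of_injective f hfinj

variable [W.IsGloballyMinimal]

/-- **`ord_p #E(ℚ)_tors ≤ 1` at an additive `p ≥ 3` with `p ∤ c_p`** (`W` globally minimal):
`#E(ℚ)_tors ∣ #E(ℚ_p)_tors ∣ c_p · p` (Silverman *AEC* VII.3.1 with VII.6.1 and `#Ẽ_ns(𝔽_p) = p`;
the b2b cell's `LocalLog.card_torsion_dvd_of_hasAdditiveReduction`), and `c_p ≠ 0`
(`localTamagawaNumber_padic_ne_zero_holds`). [cite: SilvermanAEC2009, VII.3 Prop. 3.1 with VII.6.1] -/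
theorem padicValNat_torsionOrder_le_one_of_addv_of_not_dvd (hp3 : 3 ≤ p) (hadd : Addv W p)
    (hcp : ¬ p ∣ (W.baseChange ℚ_[p]).localTamagawaNumber ℤ_[p]) :
    padicValNat p W.torsionOrder ≤ 1 := by
  haveI : (W.baseChange ℚ_[p]).IsElliptic := by rw [baseChange]; infer_instance
  haveI := Summit.BirchSwinnertonDyer.Rank1Residual.X11b.Three.JetchevKummer.hasAdditiveReduction_baseChange_padic_of_not_good_of_not_mult
    W p hadd.1 hadd.2
  have hc0 : (W.baseChange ℚ_[p]).localTamagawaNumber ℤ_[p] ≠ 0 := fun h ↦ hcp (h ▸ dvd_zero p)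
  have hne : (W.baseChange ℚ_[p]).localTamagawaNumber ℤ_[p] * p ≠ 0 := mul_ne_zero hc0 hp.out.ne_zero
  have hdvd : W.torsionOrder ∣ (W.baseChange ℚ_[p]).localTamagawaNumber ℤ_[p] * p :=
    (torsionOrder_dvd_natCard_torsion_padic W p).trans
      (LocalLog.card_torsion_dvd_of_hasAdditiveReduction (W.baseChange ℚ_[p]) hp3)
  have h1 : p ^ padicValNat p W.torsionOrder ∣ (W.baseChange ℚ_[p]).localTamagawaNumber ℤ_[p] * p :=
    pow_padicValNat_dvd.trans hdvd
  rw [padicValNat_dvd_iff_le hne, padicValNat.mul hc0 hp.out.ne_zero,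
    padicValNat.eq_zero_of_not_dvd hcp, padicValNat.self hp.out.one_lt] at h1
  omega

end GlobalToLocal

/-! ## §2 `p ≥ 5`: no `ℚ`-isogenous curve of an additive row has `p² ∣ #E'(ℚ)_tors` (no Mazur) -/

section FiveLe

variable {W W' : WeierstrassCurve ℚ} [W.IsElliptic] [W'.IsElliptic] {p : ℕ} [hp : Fact p.Prime]

/-- **`c_p ≤ 4` hence `p ∤ c_p` at an additive `p ≥ 5`** (Kodaira–Néron, Silverman *ATAEC*
Cor. IV.9.2(d): the tree's `localTamagawaNumber_padic_le_four`, the minimal model being additive,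
not split multiplicative; and `c_p ≠ 0`). [cite: SilvermanATAEC1994, Cor. IV.9.2(d) (PDF p. 340)] -/
theorem not_dvd_localTamagawaNumber_padic_of_addv_of_five_le (W : WeierstrassCurve ℚ) [W.IsElliptic]
    (p : ℕ) [hp : Fact p.Prime] (hp5 : 5 ≤ p) (hadd : Addv W p) :
    ¬ p ∣ (W.baseChange ℚ_[p]).localTamagawaNumber ℤ_[p] := by
  haveI : (W.baseChange ℚ_[p]).IsElliptic := by rw [baseChange]; infer_instance
  have hns : ¬ ((W.baseChange ℚ_[p]).minimal ℤ_[p]).HasSplitMultiplicativeReduction ℤ_[p] :=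
    fun h ↦ hadd.2 h.toHasMultiplicativeReduction
  have h4 := localTamagawaNumber_padic_le_four p (W.baseChange ℚ_[p]) hns
  have h0 : (W.baseChange ℚ_[p]).localTamagawaNumber ℤ_[p] ≠ 0 :=
    localTamagawaNumber_padic_ne_zero_holds p (W.baseChange ℚ_[p])
  intro hdvd
  have := Nat.le_of_dvd (Nat.pos_of_ne_zero h0) hdvd
  omega

/-- **`ord_p #E(ℚ)_tors ≤ 1` at an additive `p ≥ 5`**, `W` globally minimal — no Mazur.
[cite: SilvermanAEC2009, VII.3 Prop. 3.1 with VII.6.1] [cite: SilvermanATAEC1994, Cor. IV.9.2(d)] -/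
theorem padicValNat_torsionOrder_le_one_of_addv_of_five_le (W : WeierstrassCurve ℚ) [W.IsElliptic]
    [W.IsGloballyMinimal] (p : ℕ) [hp : Fact p.Prime] (hp5 : 5 ≤ p) (hadd : Addv W p) :
    padicValNat p W.torsionOrder ≤ 1 :=
  padicValNat_torsionOrder_le_one_of_addv_of_not_dvd W p (by omega) hadd
    (not_dvd_localTamagawaNumber_padic_of_addv_of_five_le W p hp5 hadd)

/-- **No `ℚ`-isogenous curve of an additive row at `p ≥ 5` has `p² ∣ #E'(ℚ)_tors`** — for EVERY
elliptic model `W'` (pass to a globally minimal model `C • W'`, Silverman *AEC* VIII.8.3, same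
torsion order; `W ~ C • W'`; additive reduction is a `ℚ`-isogeny invariant, *AEC* VII.7.2 / §C.16).
UNCONDITIONAL: the `p ≥ 5` half of the crux's torsion disjunct WITHOUT Mazur's theorem.
[cite: SilvermanAEC2009, VII.3 Prop. 3.1, VII.6.1, Cor. VII.7.2, VIII.8 Cor. 8.3] -/
theorem not_sq_dvd_torsionOrder_of_isIsogenous_of_addv (hp5 : 5 ≤ p) (hadd : Addv W p)
    (h : IsIsogenous W W') : ¬ p ^ 2 ∣ W'.torsionOrder := by
  obtain ⟨C, hC⟩ := hasGlobalMinimalModel_rat_holds W'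
  haveI := hC
  have hiso : IsIsogenous W (C • W') := h.smul_right C
  have hadd' : Addv (C • W') p := (Summit.BirchSwinnertonDyer.Rank1Residual.X2.addv_iff_of_isIsogenous (p := p) hiso).mp hadd
  have hle := padicValNat_torsionOrder_le_one_of_addv_of_five_le (C • W') p hp5 hadd'
  rw [show (C • W').torsionOrder = W'.torsionOrder from torsionOrder_variableChange_holds W' C] at hle
  intro hdvd
  have hpos : W'.torsionOrder ≠ 0 := (W'.torsionOrder_pos_holds).ne'
  have := (padicValNat_dvd_iff_le hpos).mp hdvd
  omega

end FiveLe

/-! ## §3 `p = 3`: tame additive at `3` ⟹ `3 ∤ c₃` ⟹ `9 ∤ #E(ℚ)_tors`; along an isogeny granted Ogg–Saito -/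

section Three

variable {W W' : WeierstrassCurve ℚ} [W.IsElliptic] [W'.IsElliptic]

/-- **`3 ∤ c₃` at a TAME additive `3`** (`f₃ = 2`, i.e. Kodaira `Iₙ*`, `III` or `III*` by the b2b
cell's dictionary `condExpTwo_three_iff_kodairaSymbolAt_tame`): Tate's algorithm gives `c₃ = 2` for
`III`, `III*` and `c₃ ∈ {1, 2, 4}` for `Iₙ*` (the tree's discharged facts
`localTamagawaNumber_eq_two_of_kodairaSymbolAt_eq_III_holds`, `…IIIstar_holds`,
`…Istar_zero_holds`, `…Istar_succ_holds` at `placeOf 3`, read over `ℤ_[3]` by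
`localTamagawaNumber_padic_eq_placeOf`).
[cite: SilvermanATAEC1994, IV.9.4 Steps 4, 6, 7, 9 and Table 4.1 (PDF pp. 344–346, 365)] -/
theorem not_three_dvd_localTamagawaNumber_padic_of_condExpTwo_three (W : WeierstrassCurve ℚ)
    [W.IsElliptic] [Fact (Nat.Prime 3)] (hadd : Addv W 3) (hf : CondExpTwo W 3) :
    ¬ 3 ∣ (W.baseChange ℚ_[3]).localTamagawaNumber ℤ_[3] := by
  rw [localTamagawaNumber_padic_eq_placeOf W 3]
  rcases (condExpTwo_three_iff_kodairaSymbolAt_tame W hadd).mp hf with hIII | hIIIs | ⟨n, hn⟩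
  · rw [localTamagawaNumber_eq_two_of_kodairaSymbolAt_eq_III_holds (placeOf 3) W hIII]; decide
  · rw [localTamagawaNumber_eq_two_of_kodairaSymbolAt_eq_IIIstar_holds (placeOf 3) W hIIIs]; decide
  · rcases n with _ | n
    · rcases localTamagawaNumber_of_kodairaSymbolAt_eq_Istar_zero_holds (placeOf 3) W hn with h | h | h <;>
        rw [h] <;> decide
    · rcases localTamagawaNumber_of_kodairaSymbolAt_eq_Istar_succ_holds (placeOf 3) W n hn with h | h <;>
        rw [h] <;> decide

/-- **`9 ∤ #E(ℚ)_tors` on a globally minimal curve that is additive and TAME at `3`** (`f₃ = 2`):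
`3 ∤ c₃` and §1. [cite: SilvermanAEC2009, VII.3 Prop. 3.1 with VII.6.1]
[cite: SilvermanATAEC1994, IV.9.4 and Table 4.1 (PDF p. 365)] -/
theorem not_nine_dvd_torsionOrder_of_condExpTwo_three (W : WeierstrassCurve ℚ) [W.IsElliptic]
    [W.IsGloballyMinimal] [Fact (Nat.Prime 3)] (hadd : Addv W 3) (hf : CondExpTwo W 3) :
    ¬ 3 ^ 2 ∣ W.torsionOrder := by
  have hle := padicValNat_torsionOrder_le_one_of_addv_of_not_dvd W 3 le_rfl hadd
    (not_three_dvd_localTamagawaNumber_padic_of_condExpTwo_three W hadd hf)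
  intro hdvd
  have hpos : W.torsionOrder ≠ 0 := (W.torsionOrder_pos_holds).ne'
  have := (padicValNat_dvd_iff_le hpos).mp hdvd
  omega

/-- **On a (t′) row at `3`, no `ℚ`-isogenous curve has `9 ∣ #E'(ℚ)_tors` — granted Ogg–Saito.**
For `W` additive at `3` of census type (t′) (`SubTprime W 3`: in particular `f₃ = 2`) and
`W ~ W'` over `ℚ`: a globally minimal model `C • W'` is additive at `3` (*AEC* VII.7.2 / §C.16) with
the SAME conductor exponent `f₃ = 2` (Silverman *ATAEC* Exercise 4.40, the tree's
`IsIsogenous.conductorExponent_int_eq_of_forall_tate`, GRANTED the Ogg–Saito comparison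
`a_v(V_ℓ E) = f_v(E)` for every curve — the named fact
`artinConductorExponent_tate_eq_conductorExponent_of_isElliptic`, binder `hOS`), hence tame, hence
`9 ∤ #(C • W')(ℚ)_tors = #W'(ℚ)_tors`. CONDITIONAL on `hOS`; nothing about it is asserted.
[cite: SilvermanATAEC1994, Exercise 4.40 (PDF p. 380), Thm. IV.10.2 and IV.11.1 (PDF p. 365)]
[cite: SilvermanAEC2009, VII.3 Prop. 3.1, Cor. VII.7.2, VIII.8 Cor. 8.3] -/
theorem not_nine_dvd_torsionOrder_of_isIsogenous_of_subTprime_three [W.IsGloballyMinimal]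
    [Fact (Nat.Prime 3)]
    (hOS : ∀ (V : WeierstrassCurve ℚ) (ℓ : ℕ) [Fact ℓ.Prime],
      V.artinConductorExponent_tate_eq_conductorExponent_of_isElliptic ℓ)
    (hadd : Addv W 3) (hT : SubTprime W 3) (h : IsIsogenous W W') : ¬ 3 ^ 2 ∣ W'.torsionOrder := by
  obtain ⟨C, hC⟩ := hasGlobalMinimalModel_rat_holds W'
  haveI := hC
  have hiso : IsIsogenous W (C • W') := h.smul_right C
  have hadd' : Addv (C • W') 3 := (Summit.BirchSwinnertonDyer.Rank1Residual.X2.addv_iff_of_isIsogenous (p := 3) hiso).mp hadd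
  have hf : CondExpTwo W 3 := hT.2.1
  have hf' : CondExpTwo (C • W') 3 := by
    unfold CondExpTwo condExp at hf ⊢
    rw [← hiso.conductorExponent_int_eq_of_forall_tate (hOS W) (hOS (C • W')) (placeOf 3)]
    exact hf
  have h9 := not_nine_dvd_torsionOrder_of_condExpTwo_three (C • W') hadd' hf'
  rwa [show (C • W').torsionOrder = W'.torsionOrder from torsionOrder_variableChange_holds W' C] at h9

end Three

/-! ## §4 The reshaped composition of the crux BY NAME -/

/-- An odd prime other than `3` is at least `5`. [folklore] -/
private theorem five_le_of_prime_of_ne_two_of_ne_three'' {p : ℕ} (hp : p.Prime) (h2 : p ≠ 2)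
    (h3 : p ≠ 3) : 5 ≤ p := by
  rcases Nat.lt_or_ge p 5 with h | h
  · have h2le := hp.two_le
    interval_cases p
    · exact absurd rfl h2
    · exact absurd rfl h3
    · exact absurd hp (by decide)
  · exact h

/-- **RESHAPED COMPOSITION of the row crux `TameUpperReducibleDefect` BY NAME, with NO named fact**:
the crux follows from (i) the upper half on the rank-`0` (t′) rows with `E[p]` reducible and
`ord_p #Ш_an(E)` ODD, and (ii) the upper half at `p = 3` on the rank-`0` (t′) rows with `E[3]`
reducible and some `ℚ`-isogenous `E'` with `9 ∣ #E'(ℚ)_tors` — g0's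
`tameUpperReducibleDefect_of_mazur_of_oddParity_of_nineTorsion` WITHOUT Mazur's theorem: at `p ≥ 5`
the torsion disjunct is refuted by `not_sq_dvd_torsionOrder_of_isIsogenous_of_addv` (local torsion at
the additive prime). Nothing about (i), (ii) is asserted (conditional: the item is NOT closed).
[cite: SilvermanAEC2009, VII.3 Prop. 3.1, VII.6.1, Cor. VII.7.2] -/
theorem tameUpperReducibleDefect_of_oddParity_of_nineTorsion
    (hodd : ∀ (W : WeierstrassCurve ℚ) [W.IsElliptic] [W.IsGloballyMinimal] (p : ℕ) [Fact p.Prime],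
      W.analyticRank = 0 → p ≠ 2 → Addv W p → SubTprime W p → ¬ W.HasIrreducibleModPGaloisRep p →
      (∃ q : ℚ, shaAn W = (q : ℂ) ∧ ¬ Even (padicValRat p q)) → MissingUpperBoundAt W p)
    (hnine : ∀ (W : WeierstrassCurve ℚ) [W.IsElliptic] [W.IsGloballyMinimal] [Fact (Nat.Prime 3)],
      W.analyticRank = 0 → Addv W 3 → SubTprime W 3 → ¬ W.HasIrreducibleModPGaloisRep 3 →
      (∃ (W' : WeierstrassCurve ℚ) (_ : W'.IsElliptic), IsIsogenous W W' ∧ 9 ∣ W'.torsionOrder) →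
      MissingUpperBoundAt W 3) :
    Summit.BirchSwinnertonDyer.BirchSwinnertonDyer.Theses.KatoDescentTamePotSupersingular.TameUpperReducibleDefect := by
  intro W _ _ p _ hr hp2 hadd hT hred hdef
  by_cases hpar : ∀ q : ℚ, shaAn W = (q : ℂ) → Even (padicValRat p q)
  · -- the parity clause holds, so the torsion clause fails: some isogenous `W'` has `p² ∣ #W'(ℚ)_tors`
    have htor : ¬ ∀ (W' : WeierstrassCurve ℚ) [W'.IsElliptic],
        IsIsogenous W W' → ¬ p ^ 2 ∣ W'.torsionOrder := fun h ↦ hdef ⟨h, hpar⟩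
    push Not at htor
    obtain ⟨W', hW', hiso, hdvd⟩ := htor
    by_cases h3 : p = 3
    · subst h3
      exact hnine W hr hadd hT hred ⟨W', hW', hiso, by simpa using hdvd⟩
    · exact absurd hdvd (not_sq_dvd_torsionOrder_of_isIsogenous_of_addv
        (five_le_of_prime_of_ne_two_of_ne_three'' Fact.out hp2 h3) hadd hiso)
  · push Not at hpar
    obtain ⟨q, hq, hodd'⟩ := hpar
    exact hodd W p hr hp2 hadd hT hred ⟨q, hq, hodd'⟩

/-- **RESHAPED COMPOSITION of the row crux `TameUpperReducibleDefect` BY NAME — granted the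
Ogg–Saito schema, the crux IS its odd-parity rows**: for every (t′) rank-`0` row with `E[p]`
reducible, the `ℤ/p²`-member disjunct is void (`p ≥ 5`: §2, unconditionally; `p = 3`: §3, via the
isogeny invariance of `f₃` granted `hOS`), so `TameUpperReducibleDefect` follows from the upper half on
the rows with `ord_p #Ш_an(E)` ODD alone — rows that are EMPTY in the BSD-true world (`#Ш_an = #Ш`
a square by Cassels–Tate) and are the tenure planner's queued retype of item 19203 (TARGET R99).
CONDITIONAL on `hOS` and `hodd`; nothing about either is asserted; the item is NOT closed.
[cite: SilvermanATAEC1994, Exercise 4.40 (PDF p. 380), Thm. IV.10.2, IV.11.1]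
[cite: SilvermanAEC2009, VII.3 Prop. 3.1, VII.6.1, Cor. VII.7.2, VIII.8 Cor. 8.3] -/
theorem tameUpperReducibleDefect_of_oggSaito_of_oddParity
    (hOS : ∀ (V : WeierstrassCurve ℚ) (ℓ : ℕ) [Fact ℓ.Prime],
      V.artinConductorExponent_tate_eq_conductorExponent_of_isElliptic ℓ)
    (hodd : ∀ (W : WeierstrassCurve ℚ) [W.IsElliptic] [W.IsGloballyMinimal] (p : ℕ) [Fact p.Prime],
      W.analyticRank = 0 → p ≠ 2 → Addv W p → SubTprime W p → ¬ W.HasIrreducibleModPGaloisRep p →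
      (∃ q : ℚ, shaAn W = (q : ℂ) ∧ ¬ Even (padicValRat p q)) → MissingUpperBoundAt W p) :
    Summit.BirchSwinnertonDyer.BirchSwinnertonDyer.Theses.KatoDescentTamePotSupersingular.TameUpperReducibleDefect :=
  tameUpperReducibleDefect_of_oddParity_of_nineTorsion hodd
    fun W _ _ _ _ hadd hT _ ⟨W', hW', hiso, h9⟩ ↦
      absurd (by simpa using h9) (not_nine_dvd_torsionOrder_of_isIsogenous_of_subTprime_three hOS hadd hT hiso)

/-! ## §5 U₀'s bill with the reducible child reshaped: Conj A on the non-CM U₀-ns rows (resp. on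
the ♯ rows only, with L₀ and `TameRankOne`) + the odd-parity rows + Ogg–Saito + cite-level -/

/-- **Item 19982 `TameUpperDefectRankZero` (U₀) BY NAME from the route items 19387 ∧ 19191 ∧ 19413,
the Ogg–Saito schema and the ODD-PARITY rows of 19203** — g2's `tameUpperDefectRankZero_of_items`
with the reducible child supplied by §4. So after this file U₀(t′) costs exactly: Coates–Sujatha's (A)
on the non-CM U₀-ns rows (crux 19413) + the upper half on the reducible odd-parity rows + published
inputs (Kato's fine-Selmer / Tamagawa-exact readings, Burungale–Flach, GZK, modularity, Ogg–Saito).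
Conditional over items / named facts / the parity rows; nothing asserted; NO item is closed.
[cite: Kato2004Asterisque, Thm. 14.5 (3) (p. 236), Prop. 14.16 (2) (p. 244)]
[cite: CoatesSujatha2005, Conjecture A] [cite: SilvermanATAEC1994, Exercise 4.40, Thm. IV.10.2, IV.11.1] -/
theorem tameUpperDefectRankZero_of_items_of_oggSaito_of_oddParity (hF : PublishedInputsFineSelmerCM)
    (hK : KatoTamagawaExactInputs) (hCS : TameFineSelmerCoatesSujatha)
    (hOS : ∀ (V : WeierstrassCurve ℚ) (ℓ : ℕ) [Fact ℓ.Prime],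
      V.artinConductorExponent_tate_eq_conductorExponent_of_isElliptic ℓ)
    (hodd : ∀ (W : WeierstrassCurve ℚ) [W.IsElliptic] [W.IsGloballyMinimal] (p : ℕ) [Fact p.Prime],
      W.analyticRank = 0 → p ≠ 2 → Addv W p → SubTprime W p → ¬ W.HasIrreducibleModPGaloisRep p →
      (∃ q : ℚ, shaAn W = (q : ℂ) ∧ ¬ Even (padicValRat p q)) → MissingUpperBoundAt W p) :
    Summit.BirchSwinnertonDyer.BirchSwinnertonDyer.Theses.KatoDescentTamePotSupersingular.TameUpperDefectRankZero :=
  tameUpperDefectRankZero_of_items hF hK hCS (tameUpperReducibleDefect_of_oggSaito_of_oddParity hOS hodd)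

/-- **THE EXACT BILL OF U₀ = `TameUpperDefectRankZero` (item 19982) over the route's own nodes**: the
lower half L₀ (`TameLowerHalfRankZero`, rationality of `L(E,1)/Ω` only), the declared residual
`TameRankOne` (the rank-ONE Heegner twist of a (t′) row is a (t′) row), Coates–Sujatha's (A) on the
NON-CM U₀-ns rows with `ρ̄_{E,p}` not onto AND Tamagawa–Manin-dirty ONLY (the ♯ rows of crux 19413:
`p ∣ ∏ c_ℓ(E)` or no datum at level `N_E` with `p ∤ c`), the upper half on the reducible ODD-PARITY
rows (the content of 19203 after §4), and PUBLISHED inputs by name — Gross–Zagier, Kolyvagin,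
Matar–Nekovář's irreducible Kolyvagin bound, newforms, Bump–Friedberg–Hoffstein, Kato's Tamagawa-exact
and fine-Selmer readings + GZK + modularity (`KatoTamagawaExactInputs`, `PublishedInputsFineSelmerCM`,
incl. Burungale–Flach on CM rows), and the Ogg–Saito schema. Composition of g2's
`tameUpperNonsurjTower_of_tameLower_of_tameRankOne_of_fineSelmerSharp` (♭ rows by the Heegner road),
§4, and the proved split glue `tameUpperDefectOfSplit_proof` (item 19204). Conditional throughout;
nothing asserted; NO item is closed; BSD is not proved by any of this.
[cite: MatarNekovar2019, Thm. 0.3 and §0.11 (pp. 456–457)] [cite: GrossZagier1986, Thm. I.6.3]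
[cite: Kato2004Asterisque, Thm. 14.5 (3) (p. 236), Prop. 14.16 (2) (p. 244)]
[cite: CoatesSujatha2005, Conjecture A] [cite: SilvermanATAEC1994, Exercise 4.40, Thm. IV.10.2, IV.11.1] -/
theorem tameUpperDefectRankZero_bill_of_lower_of_rankOne_of_fineSelmerSharp_of_oggSaito_of_oddParity
    (hGZ : ∀ (N : ℕ) [NeZero N] (W : WeierstrassCurve ℚ) (K : Type) [Field K] [NumberField K],
      gross_zagier N W K)
    (hKo : ∀ (N : ℕ) [NeZero N] (W : WeierstrassCurve ℚ) (K : Type) [Field K] [NumberField K],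
      kolyvagin N W K)
    (hMN : ∀ (N : ℕ) [NeZero N] (W : WeierstrassCurve ℚ) (K : Type) [Field K] [NumberField K],
      MatarNekovar2019.thm03_padicValNat_card_sha_le_of_irreducible N W K)
    (hnf : exists_isNewformOf) (hBFH : bumpFriedbergHoffstein_exists_heegnerField_split_twist_simpleZero)
    (hK : KatoTamagawaExactInputs) (hF : PublishedInputsFineSelmerCM)
    (hOS : ∀ (V : WeierstrassCurve ℚ) (ℓ : ℕ) [Fact ℓ.Prime],
      V.artinConductorExponent_tate_eq_conductorExponent_of_isElliptic ℓ)
    (h₂ : TameLowerHalfRankZero) (hR : TameRankOne)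
    (hCSsharp : ∀ (W : WeierstrassCurve ℚ) [W.IsElliptic] [W.IsGloballyMinimal] (p : ℕ) [Fact p.Prime],
      W.analyticRank = 0 → p ≠ 2 → Addv W p → SubTprime W p → ¬ W.HasCM →
      W.HasIrreducibleModPGaloisRep p → ¬ W.HasSurjectiveModNGaloisRep p →
      (p ∣ W.tamagawaProduct ∨ ∀ [NeZero (W.conductorNorm ℤ)]
        (D : ModularParametrizationData W (W.conductorNorm ℤ)), (p : ℤ) ∣ D.c) →
      ∀ (κ : ZpExtension ℚ p), κ.IsCyclotomic →
        ∃ (γ : Field.absoluteGaloisGroup ℚ) (D : W.FineSelmerDualData κ γ),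
          Module.Finite ℤ_[p] (RestrictScalars ℤ_[p] (IwasawaAlgebra p) D.X))
    (hodd : ∀ (W : WeierstrassCurve ℚ) [W.IsElliptic] [W.IsGloballyMinimal] (p : ℕ) [Fact p.Prime],
      W.analyticRank = 0 → p ≠ 2 → Addv W p → SubTprime W p → ¬ W.HasIrreducibleModPGaloisRep p →
      (∃ q : ℚ, shaAn W = (q : ℂ) ∧ ¬ Even (padicValRat p q)) → MissingUpperBoundAt W p) :
    Summit.BirchSwinnertonDyer.BirchSwinnertonDyer.Theses.KatoDescentTamePotSupersingular.TameUpperDefectRankZero :=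
  tameUpperDefectOfSplit_proof
    (tameUpperNonsurjTower_of_tameLower_of_tameRankOne_of_fineSelmerSharp hGZ hKo hMN hnf hBFH hK hF h₂ hR
      hCSsharp)
    (tameUpperReducibleDefect_of_oggSaito_of_oddParity hOS hodd) hK

end Summit.BirchSwinnertonDyer.BirchSwinnertonDyer.Theorems

end
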